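import Mathlib
import Literature.Computability.Cryptography.OneWayFunctions
import Literature.Computability.Cryptography.CryptoFoundationsOneWayFunctions
import Literature.Computability.Cryptography.CryptoFoundationsOneWayFunctionsProofs
import Literature.Computability.Cryptography.CryptoFoundationsOneWayFunctionsGLProofs
import Literature.Computability.Cryptography.CryptoFoundationsOneWayFunctionsS24Proofs
import Literature.Computability.Cryptography.OneWayFunctionsPneNP
import Summits.PneNP.Statement
import HarnessLib

/-!
# Route LatticeMagic, crux `Target` (stmt-PneNP-10709) — line `SketchIdeator5`: strength of apex A

Apex A of the line (`stub_injOWF` of `Cruxes/Target/Lines/SketchIdeator5.lean`) is the cryptographic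
hypothesis "some polynomial-time `g` is injective on every length, length-regular and one-way, and has a
hard-core predicate `B`" (stated below with the injectivity clause written out, so that this file needs
no line vocabulary). Two kernel-checked facts about it, both from LANDED tree theorems:

* `injOWF_of_oneWayPermutation` — apex A follows from the existence of a one-way PERMUTATION
  (a length-preserving, length-wise injective one-way `f`): take `g = glFun f`, `B = glPred`, by the
  tree's proved Goldreich–Levin theorem (`goldreich_levin_holds`) and `isOneWay_glFun_holds`
  [Goldreich 2001, Thm. 2.5.2]. So apex A is a Minicrypt assumption (Krajíček's Lemma 2.2 hypothesis,
  arXiv:2506.20221 §2, in its uniform form).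
* `P_ne_NP_of_injOWF`, `pneNP_of_injOWF` — apex A implies `P ≠ NP`, indeed the summit statement
  `PneNP` itself (`P_ne_NP_of_OWFExist_holds`, `pneNP_shape_of_OWFExist` [Goldreich 2001, §2.7.4
  Ex. 2]): the line's cryptographic leg is ≥ the SUMMIT (though not known ≥ the crux `NP ≠ coNP`),
  the price tag recorded on the card.
-/

set_option linter.dupNamespace false -- `Summit.PneNP.PneNP.…`: summit = sub-problem (D-0017)

namespace Summit.PneNP.PneNP.Theorems.LatticeMagicTarget

open Literature.Computability.Complexity Literature.Computability.Cryptography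
open _root_.Computability

/-- The Goldreich–Levin function of a length-preserving `f` is length-preserving:
`|glFun f z| = |f (take ⌊|z|/2⌋ z)| + |drop ⌊|z|/2⌋ z| = |z|`. [cite: Goldreich2001, Thm. 2.5.2] -/
theorem isLengthPreserving_glFun {f : List Bool → List Bool} (hl : IsLengthPreserving f) :
    IsLengthPreserving (glFun f) := by
  intro z
  simp only [glFun, List.length_append, hl _, List.length_take, List.length_drop]
  omega

/-- The Goldreich–Levin function of a length-preserving, length-wise injective `f` is length-wise
injective: from `f x ++ r = f x' ++ r'` with `|f x| = |f x'|` get `f x = f x'` and `r = r'`.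
[cite: Goldreich2001, Thm. 2.5.2] -/
theorem glFun_injOnLengths {f : List Bool → List Bool} (hl : IsLengthPreserving f)
    (hinj : ∀ x y : List Bool, x.length = y.length → f x = f y → x = y)
    (z z' : List Bool) (hzz' : z.length = z'.length) (h : glFun f z = glFun f z') : z = z' := by
  simp only [glFun] at h
  have hlen : (f (z.take (z.length / 2))).length = (f (z'.take (z'.length / 2))).length := by
    rw [hl, hl, List.length_take, List.length_take, hzz']
  obtain ⟨h1, h2⟩ := List.append_inj h hlen
  have htake : z.take (z.length / 2) = z'.take (z'.length / 2) :=
    hinj _ _ (by rw [List.length_take, List.length_take, hzz']) h1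
  rw [← List.take_append_drop (z.length / 2) z, ← List.take_append_drop (z'.length / 2) z', htake, h2]

/-- **Apex A from a one-way permutation.** If some `f` is one-way, length-preserving and injective on
every length (a uniform one-way permutation), then some `g` is injective on every length,
length-regular and one-way with a hard-core predicate: `g = glFun f`, `B = glPred` (Goldreich–Levin,
PROVED in the tree: `goldreich_levin_holds`, `isOneWay_glFun_holds`). [cite: Goldreich2001, Thm. 2.5.2] -/
theorem injOWF_of_oneWayPermutation
    (h : ∃ f : List Bool → List Bool, IsOneWay f ∧ IsLengthPreserving f ∧
      ∀ x y : List Bool, x.length = y.length → f x = f y → x = y) :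
    ∃ (g : List Bool → List Bool) (B : List Bool → Bool),
      (∀ x y : List Bool, x.length = y.length → g x = g y → x = y) ∧
        IsLengthRegular g ∧ IsOneWay g ∧ IsHardCorePredicate B g := by
  obtain ⟨f, hf, hl, hinj⟩ := h
  exact ⟨glFun f, glPred, glFun_injOnLengths hl hinj, (isLengthPreserving_glFun hl).isLengthRegular,
    isOneWay_glFun_holds hf hl, goldreich_levin_holds hf hl⟩

/-- **Apex A implies `P ≠ NP`** (over the tree's `Classes.P`, `Nondeterministic.NP`): a one-way function
exists, and `OWFExist → P ≠ NP` is the proved tree theorem `P_ne_NP_of_OWFExist_holds`.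
[cite: Goldreich2001, §2.7.4 Exercise 2] -/
theorem P_ne_NP_of_injOWF
    (h : ∃ (g : List Bool → List Bool) (B : List Bool → Bool),
      (∀ x y : List Bool, x.length = y.length → g x = g y → x = y) ∧
        IsLengthRegular g ∧ IsOneWay g ∧ IsHardCorePredicate B g) :
    Classes.P ≠ Nondeterministic.NP := by
  obtain ⟨g, _B, _hinj, _hreg, hg, _hB⟩ := h
  exact P_ne_NP_of_OWFExist_holds ⟨g, hg⟩

/-- **Apex A already proves the summit.** The cryptographic leg of the line implies Cook's `P ≠ NP` in the
Clay form `PneNP` (`pneNP_shape_of_OWFExist`): the kernel-checked price tag of every line through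
Krajíček's squeeze — it cannot be the way route LatticeMagic closes the summit non-circularly; what it
isolates is the crux's surplus `NP ≠ coNP` over `P ≠ NP`. [cite: Goldreich2001, §2.7.4 Exercise 2] -/
theorem pneNP_of_injOWF
    (h : ∃ (g : List Bool → List Bool) (B : List Bool → Bool),
      (∀ x y : List Bool, x.length = y.length → g x = g y → x = y) ∧
        IsLengthRegular g ∧ IsOneWay g ∧ IsHardCorePredicate B g) :
    _root_.PneNP := by
  obtain ⟨g, _B, _hinj, _hreg, hg, _hB⟩ := h
  exact pneNP_shape_of_OWFExist ⟨g, hg⟩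

end Summit.PneNP.PneNP.Theorems.LatticeMagicTarget
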